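import Literature.MathematicalPhysics.QuantumManyBody.LiebYngvasonPoincare
import Literature.MathematicalPhysics.QuantumManyBody.OneBodyCurrentGain
import Literature.MathematicalPhysics.QuantumManyBody.PeriodicBoseGasRelabelling
import Mathlib.MeasureTheory.Integral.Prod
import HarnessLib

/-!
# The tagged pair of an `(N'+2)`-body wave function: calculus, Fubini, Bose symmetry (helper file)

Route `BECStronglyRayleigh`, crux `LatticeToPeriodicBridge` (stmt-AtomisticToContinuum-9674),
line `coarse-cell-lorentzian`, stub `stub_cellNormRetention` (S2, cell norm retention): second
of three files (`…CellPoincare`, `…CellPairSplit`, `…CellNormRetention`); generic bookkeeping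
for the tagged pair `(ξ, η)` in slots `0, 1` of a configuration `(ξ, η, X') ∈ (ℝ³)^{N'+2}`,
written `Fin.cons ξ (Fin.cons η X')` (definitionally the line's `pairConfig ξ η X'`; this file
does not import the line's `Defs` module).

* Calculus (`pairCLM`, `hasFDerivAt_finCons_finCons`, `fderiv_re_finCons`,
  `gradSq_re_finCons_le`): `(ξ, η) ↦ (ξ, η, X')` is affine with linear part
  `pairCLM (v, w) = (v, w, 0)`, `pairCLM (v, 0) = e₀ ⊗ v`, `pairCLM (0, w) = e₁ ⊗ w`, so the
  Dirichlet integrand of `G = Re Ψ(·, ·, X')` on `ℝ³ × ℝ³` is at most the kinetic energy density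
  `kinPart 0 Ψ + kinPart 1 Ψ` of particles `0` and `1` at `(ξ, η, X')` (`|Re z| ≤ |z|`).
* Fubini (`pairMeasurableEquiv`, `measurePreserving_pairMeasurableEquiv`,
  `integral_cellN_eq_integral_pair`, `integrableOn_integral_pair`): the splitting
  `(ξ, η, X') ↦ (X', (ξ, η))` (Mathlib's `piFinSuccAbove` at slot `0` twice, re-associated and
  swapped) carries `dX|_{cell^{N'+2}}` to `dX'|_{cell^{N'}} ⊗ (dξ|_{cell} ⊗ dη|_{cell})`, so
  `∫_{cell^{N'+2}} h = ∫_{X'} ∫_{(ξ,η)} h(ξ, η, X')` for continuous `h`, with an integrable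
  inner integral.
* Bose symmetry (`kinPartE`, `kinPartE_eq_comp_swap`, `setLIntegral_kinPartE_eq`,
  `lintegral_kineticDensity_eq_mul`): for a permutation-symmetric `Ψ ∈ C¹`,
  `|∂_{i,k}Ψ(X)| = |∂_{0,k}Ψ(X ∘ (0 i))|` (chain rule for the relabelling isometry), and Lebesgue
  measure on the cell is relabelling invariant (`setLIntegral_cellN_comp_perm`), so every particle
  carries the same kinetic energy: `∫_{cell}|∇Ψ|² = (n+1) ∫_{cell} ∑ₖ|∂_{0,k}Ψ|²`.

Sub-namespace `….CoarseCellLorentzian.CellNormRetention`. `HasFDerivAt.finCons`,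
`measurePreserving_prodAssoc`, `Measure.measurePreserving_swap`, `integral_prod`,
`Integrable.integral_prod_left` are Mathlib's; `measurePreserving_piFinSuccAbove_cellN`,
`integrableOn_cellN`, `relabelCLM`, `single_comp_perm`, `setLIntegral_cellN_comp_perm`,
`Poincare.cons_zero_eq_single` are the tree's. References: LSSY2005 §1.2 (1.16) (the kinetic energy `∑ᵢ|∇ᵢΨ|²` of bosons);
Fournais 2020 (1.1) (the torus cell).
-/

noncomputable section

open MeasureTheory Filter Metric Set
open scoped ENNReal Topology NNReal Real

namespace Summit.AtomisticToContinuum.BoseEinsteinCondensation.Cruxes.LatticeToPeriodicBridge.CoarseCellLorentzian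

namespace CellNormRetention

open Literature.MathematicalPhysics.QuantumManyBody.BoseGas
open Literature.MathematicalPhysics.QuantumManyBody.BoseGas.Poincare

/-! ## The tagged pair `(ξ, η) ↦ (ξ, η, X')` and its derivative -/

section Pair

variable {N' : ℕ}

/-- The linear part `(ξ, η) ↦ (ξ, η, 0, …, 0)` of the affine embedding `(ξ, η) ↦ (ξ, η, X')`.
[folklore] -/
def pairCLM (N' : ℕ) : Space × Space →L[ℝ] Config (N' + 2) :=
  ContinuousLinearMap.finCons (M := fun _ : Fin (N' + 2) => Space)
    (ContinuousLinearMap.fst ℝ Space Space)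
    (ContinuousLinearMap.finCons (M := fun _ : Fin (N' + 1) => Space)
      (ContinuousLinearMap.snd ℝ Space Space) (0 : Space × Space →L[ℝ] (Fin N' → Space)))

/-- `pairCLM (ξ, η) = (ξ, η, 0)`. [folklore] -/
theorem pairCLM_apply (p : Space × Space) :
    pairCLM N' p = Fin.cons p.1 (Fin.cons p.2 (0 : Config N')) := rfl

/-- `(ξ, 0, 0) = e₀ ⊗ ξ`. [folklore] -/
theorem pairCLM_apply_inl (v : Space) : pairCLM N' (v, 0) = Pi.single 0 v := by
  rw [pairCLM_apply]
  have h0 : (Fin.cons (0 : Space) (0 : Config N') : Config (N' + 1)) = 0 := by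
    funext j
    refine Fin.cases ?_ (fun k => ?_) j <;> simp
  dsimp only
  rw [h0, cons_zero_eq_single]

/-- `(0, η, 0) = e₁ ⊗ η`. [folklore] -/
theorem pairCLM_apply_inr (v : Space) : pairCLM N' (0, v) = Pi.single 1 v := by
  rw [pairCLM_apply]
  dsimp only
  rw [cons_zero_eq_single, cons_single_eq_single_succ]
  rfl

/-- The embedding `(ξ, η) ↦ (ξ, η, X')` is affine with linear part `pairCLM`. [folklore] -/
theorem hasFDerivAt_finCons_finCons (X' : Config N') (p : Space × Space) :
    HasFDerivAt (fun q : Space × Space => (Fin.cons q.1 (Fin.cons q.2 X') : Config (N' + 2)))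
      (pairCLM N') p :=
  hasFDerivAt_fst.finCons (hasFDerivAt_snd.finCons (hasFDerivAt_const X' p))

/-- `(X', (ξ, η)) ↦ (ξ, η, X')` is (jointly) continuous. [folklore] -/
theorem continuous_finCons_finCons :
    Continuous fun q : Config N' × (Space × Space) =>
      (Fin.cons q.2.1 (Fin.cons q.2.2 q.1) : Config (N' + 2)) := by
  refine Continuous.finCons (A := fun _ : Fin (N' + 2) => Space) continuous_snd.fst ?_
  exact Continuous.finCons (A := fun _ : Fin (N' + 1) => Space) continuous_snd.snd continuous_fst

/-- `(ξ, η) ↦ (ξ, η, X')` is continuous. [folklore] -/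
theorem continuous_finCons_finCons_left (X' : Config N') :
    Continuous fun p : Space × Space => (Fin.cons p.1 (Fin.cons p.2 X') : Config (N' + 2)) :=
  continuous_finCons_finCons.comp (Continuous.prodMk continuous_const continuous_id)

/-- The real part of a complex `C¹` wave function along the tagged pair,
`G(ξ, η) = Re Ψ(ξ, η, X')`, is `C¹`. [folklore] -/
theorem contDiff_re_finCons {Ψ : Config (N' + 2) → ℂ} (hΨ : ContDiff ℝ 1 Ψ) (X' : Config N') :
    ContDiff ℝ 1 fun p : Space × Space => (Ψ (Fin.cons p.1 (Fin.cons p.2 X'))).re := by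
  have h1 : ContDiff ℝ 1 fun p : Space × Space =>
      (Fin.cons p.1 (Fin.cons p.2 X') : Config (N' + 2)) := by
    have : (fun p : Space × Space => (Fin.cons p.1 (Fin.cons p.2 X') : Config (N' + 2))) =
        fun p => pairCLM N' p + Fin.cons 0 (Fin.cons 0 X') := by
      funext p
      rw [pairCLM_apply]
      funext j
      refine Fin.cases ?_ (fun k => Fin.cases ?_ (fun l => ?_) k) j <;> simp
    rw [this]
    exact (pairCLM N').contDiff.add contDiff_const
  exact Complex.reCLM.contDiff.comp (hΨ.comp h1)

/-- **Chain rule along the tagged pair**: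
`∂_w Re Ψ(ξ, η, X') = Re (DΨ(ξ, η, X') · pairCLM w)`. [folklore] -/
theorem fderiv_re_finCons {Ψ : Config (N' + 2) → ℂ} (hΨ : Differentiable ℝ Ψ) (X' : Config N')
    (p w : Space × Space) :
    fderiv ℝ (fun q : Space × Space => (Ψ (Fin.cons q.1 (Fin.cons q.2 X'))).re) p w =
      (fderiv ℝ Ψ (Fin.cons p.1 (Fin.cons p.2 X')) (pairCLM N' w)).re := by
  have h1 := (hΨ _).hasFDerivAt.comp p (hasFDerivAt_finCons_finCons X' p)
  have h2 := (Complex.reCLM.hasFDerivAt.comp p h1).fderiv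
  rw [show (fun q : Space × Space => (Ψ (Fin.cons q.1 (Fin.cons q.2 X'))).re) =
      (⇑Complex.reCLM ∘ (Ψ ∘ fun q : Space × Space =>
        (Fin.cons q.1 (Fin.cons q.2 X') : Config (N' + 2)))) from rfl, h2]
  rfl

/-- The kinetic energy density of particle `i`, `∑ₖ |∂Ψ/∂x_{i,k}(X)|²` (real). [folklore] -/
def kinPart {N : ℕ} (i : Fin N) (Ψ : Config N → ℂ) (X : Config N) : ℝ :=
  ∑ k : Fin 3, ‖fderiv ℝ Ψ X (Pi.single i (EuclideanSpace.single k (1 : ℝ)))‖ ^ 2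

/-- `∑ₖ |∂Ψ/∂x_{i,k}|² ≥ 0`. [folklore] -/
theorem kinPart_nonneg {N : ℕ} (i : Fin N) (Ψ : Config N → ℂ) (X : Config N) :
    0 ≤ kinPart i Ψ X :=
  Finset.sum_nonneg fun _ _ => sq_nonneg _

/-- `X ↦ ∑ₖ |∂Ψ/∂x_{i,k}(X)|²` is continuous for `Ψ ∈ C¹`. [folklore] -/
theorem continuous_kinPart {N : ℕ} (i : Fin N) {Ψ : Config N → ℂ} (hΨ : ContDiff ℝ 1 Ψ) :
    Continuous (kinPart i Ψ) := by
  unfold kinPart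
  have hc := hΨ.continuous_fderiv one_ne_zero
  fun_prop

/-- **The Dirichlet integrand of `G = Re Ψ(·, ·, X')` is at most the kinetic energy density of
particles `0` and `1`**: `|∇_ξ G|² + |∇_η G|² ≤ ∑ₖ |∂_{0,k}Ψ|² + ∑ₖ |∂_{1,k}Ψ|²` at `(ξ, η, X')`
(`|Re z| ≤ |z|`). [folklore] -/
theorem gradSq_re_finCons_le {Ψ : Config (N' + 2) → ℂ} (hΨ : Differentiable ℝ Ψ)
    (X' : Config N') (p : Space × Space) :
    ((∑ k, fderiv ℝ (fun q : Space × Space => (Ψ (Fin.cons q.1 (Fin.cons q.2 X'))).re) p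
        (EuclideanSpace.single k 1, 0) ^ 2) +
      ∑ k, fderiv ℝ (fun q : Space × Space => (Ψ (Fin.cons q.1 (Fin.cons q.2 X'))).re) p
        (0, EuclideanSpace.single k 1) ^ 2) ≤
      kinPart 0 Ψ (Fin.cons p.1 (Fin.cons p.2 X')) +
        kinPart 1 Ψ (Fin.cons p.1 (Fin.cons p.2 X')) := by
  have hre : ∀ z : ℂ, z.re ^ 2 ≤ ‖z‖ ^ 2 := fun z => by
    rw [← sq_abs]
    exact pow_le_pow_left₀ (abs_nonneg _) (Complex.abs_re_le_norm z) 2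
  refine add_le_add (Finset.sum_le_sum fun k _ => ?_) (Finset.sum_le_sum fun k _ => ?_)
  · rw [fderiv_re_finCons hΨ, pairCLM_apply_inl]
    exact hre _
  · rw [fderiv_re_finCons hΨ, pairCLM_apply_inr]
    exact hre _

end Pair

/-! ## Splitting off the tagged pair: `cell^{N'+2} ≅ cell^{N'} × (cell × cell)` -/

section Split

variable {N' : ℕ}

/-- `(ξ, η, X') ↦ (X', (ξ, η))` as a measurable equivalence `(ℝ³)^{N'+2} ≃ (ℝ³)^{N'} × (ℝ³ × ℝ³)`
(Mathlib's `piFinSuccAbove` at slot `0`, twice, re-associated and swapped). [folklore] -/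
def pairMeasurableEquiv (N' : ℕ) : Config (N' + 2) ≃ᵐ Config N' × (Space × Space) :=
  (((MeasurableEquiv.piFinSuccAbove (fun _ : Fin (N' + 2) => Space) 0).trans
    (MeasurableEquiv.prodCongr (MeasurableEquiv.refl Space)
      (MeasurableEquiv.piFinSuccAbove (fun _ : Fin (N' + 1) => Space) 0))).trans
    MeasurableEquiv.prodAssoc.symm).trans MeasurableEquiv.prodComm

/-- The inverse splitting is the tagged-pair configuration `(X', (ξ, η)) ↦ (ξ, η, X')`.
[folklore] -/
theorem pairMeasurableEquiv_symm_apply (q : Config N' × (Space × Space)) :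
    (pairMeasurableEquiv N').symm q = Fin.cons q.2.1 (Fin.cons q.2.2 q.1) := by
  change Fin.insertNth (α := fun _ : Fin (N' + 2) => Space) 0 q.2.1
    (Fin.insertNth (α := fun _ : Fin (N' + 1) => Space) 0 q.2.2 q.1) = _
  rw [Fin.insertNth_zero', Fin.insertNth_zero']

/-- **The splitting carries `dX|_{cell^{N'+2}}` to `dX'|_{cell^{N'}} ⊗ (dξ|_{cell} ⊗ dη|_{cell})`.**
[folklore] -/
theorem measurePreserving_pairMeasurableEquiv (N' : ℕ) (L : ℝ) :
    MeasurePreserving (pairMeasurableEquiv N')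
      ((volume : Measure (Config (N' + 2))).restrict (cellN (N' + 2) L))
      (((volume : Measure (Config N')).restrict (cellN N' L)).prod
        (((volume : Measure Space).restrict (cell L)).prod
          ((volume : Measure Space).restrict (cell L)))) := by
  have h1 := measurePreserving_piFinSuccAbove_cellN (n := N' + 1) 0 L
  have h2 := measurePreserving_piFinSuccAbove_cellN (n := N') 0 L
  have h3 := (MeasurePreserving.id ((volume : Measure Space).restrict (cell L))).prod h2
  have h4 := h3.comp h1
  have h5 := ((measurePreserving_prodAssoc ((volume : Measure Space).restrict (cell L))
    ((volume : Measure Space).restrict (cell L))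
    ((volume : Measure (Config N')).restrict (cellN N' L))).symm
      MeasurableEquiv.prodAssoc).comp h4
  exact (Measure.measurePreserving_swap (μ := ((volume : Measure Space).restrict (cell L)).prod
    ((volume : Measure Space).restrict (cell L)))
    (ν := (volume : Measure (Config N')).restrict (cellN N' L))).comp h5

/-- **Fubini for the tagged pair** (real integrands): for `h` continuous on `(ℝ³)^{N'+2}`,
`∫_{cell^{N'+2}} h = ∫_{X' ∈ cell^{N'}} ∫_{(ξ,η)} h(ξ, η, X')`, the inner integral with respect to
`dξ|_{cell} ⊗ dη|_{cell}`. [folklore] -/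
theorem integral_cellN_eq_integral_pair {h : Config (N' + 2) → ℝ} (hh : Continuous h) (L : ℝ) :
    ∫ X in cellN (N' + 2) L, h X =
      ∫ X' in cellN N' L, ∫ p, h (Fin.cons p.1 (Fin.cons p.2 X'))
        ∂(((volume : Measure Space).restrict (cell L)).prod
          ((volume : Measure Space).restrict (cell L))) := by
  have he := (measurePreserving_pairMeasurableEquiv N' L).symm (pairMeasurableEquiv N')
  have hint : Integrable (fun q => h ((pairMeasurableEquiv N').symm q))
      (((volume : Measure (Config N')).restrict (cellN N' L)).prod
        (((volume : Measure Space).restrict (cell L)).prod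
          ((volume : Measure Space).restrict (cell L)))) :=
    (he.integrable_comp_emb (pairMeasurableEquiv N').symm.measurableEmbedding).2
      (integrableOn_cellN hh L)
  rw [← he.integral_comp' (g := h), integral_prod _ hint]
  simp only [pairMeasurableEquiv_symm_apply]

/-- The inner pair integral `X' ↦ ∫_{cell²} h(ξ, η, X')` is integrable on `cell^{N'}`.
[folklore] -/
theorem integrableOn_integral_pair {h : Config (N' + 2) → ℝ} (hh : Continuous h) (L : ℝ) :
    Integrable (fun X' : Config N' => ∫ p, h (Fin.cons p.1 (Fin.cons p.2 X'))
        ∂(((volume : Measure Space).restrict (cell L)).prod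
          ((volume : Measure Space).restrict (cell L))))
      ((volume : Measure (Config N')).restrict (cellN N' L)) := by
  have he := (measurePreserving_pairMeasurableEquiv N' L).symm (pairMeasurableEquiv N')
  have hint : Integrable (fun q => h ((pairMeasurableEquiv N').symm q))
      (((volume : Measure (Config N')).restrict (cellN N' L)).prod
        (((volume : Measure Space).restrict (cell L)).prod
          ((volume : Measure Space).restrict (cell L)))) :=
    (he.integrable_comp_emb (pairMeasurableEquiv N').symm.measurableEmbedding).2
      (integrableOn_cellN hh L)
  simpa only [pairMeasurableEquiv_symm_apply] using hint.integral_prod_left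

end Split

/-! ## Bose symmetry: every particle carries the same kinetic energy -/

section Bose

variable {n : ℕ}

/-- The kinetic energy density of particle `i`, `∑ₖ |∂Ψ/∂x_{i,k}(X)|²`, in `ℝ≥0∞`
(so that `kineticDensity Ψ X = ∑ᵢ kinPartE i Ψ X` by `rfl`). [folklore] -/
def kinPartE {N : ℕ} (i : Fin N) (Ψ : Config N → ℂ) (X : Config N) : ℝ≥0∞ :=
  ∑ k : Fin 3, (‖fderiv ℝ Ψ X (Pi.single i (EuclideanSpace.single k (1 : ℝ)))‖₊ : ℝ≥0∞) ^ 2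

/-- `|∇Ψ|² = ∑ᵢ ∑ₖ |∂_{i,k}Ψ|²`, particle by particle. [folklore] -/
theorem kineticDensity_eq_sum_kinPartE {N : ℕ} (Ψ : Config N → ℂ) (X : Config N) :
    kineticDensity Ψ X = ∑ i, kinPartE i Ψ X := rfl

/-- `kinPartE = ofReal ∘ kinPart`. [folklore] -/
theorem kinPartE_eq_ofReal {N : ℕ} (i : Fin N) (Ψ : Config N → ℂ) (X : Config N) :
    kinPartE i Ψ X = ENNReal.ofReal (kinPart i Ψ X) := by
  unfold kinPartE kinPart
  rw [ENNReal.ofReal_sum_of_nonneg (fun k _ => sq_nonneg _)]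
  exact Finset.sum_congr rfl fun k _ => coe_nnnorm_sq_eq_ofReal _

/-- `X ↦ ∑ₖ |∂_{i,k}Ψ(X)|²` is measurable for `Ψ ∈ C¹`. [folklore] -/
theorem measurable_kinPartE {N : ℕ} (i : Fin N) {Ψ : Config N → ℂ} (hΨ : ContDiff ℝ 1 Ψ) :
    Measurable (kinPartE i Ψ) := by
  have h : kinPartE i Ψ = fun X => ENNReal.ofReal (kinPart i Ψ X) :=
    funext (kinPartE_eq_ofReal i Ψ)
  rw [h]
  exact ENNReal.measurable_ofReal.comp (continuous_kinPart i hΨ).measurable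

/-- **Relabelling covariance**: for a Bose-symmetric differentiable `Ψ`, the kinetic density of
particle `i` at `X` is that of particle `0` at the relabelled configuration `X ∘ (0 i)`.
[folklore] -/
theorem kinPartE_eq_comp_swap {Ψ : Config (n + 1) → ℂ} (hΨ : Differentiable ℝ Ψ)
    (hsymm : ∀ (σ : Equiv.Perm (Fin (n + 1))) (X : Config (n + 1)), Ψ (X ∘ σ) = Ψ X)
    (i : Fin (n + 1)) (X : Config (n + 1)) :
    kinPartE i Ψ X = kinPartE 0 Ψ (X ∘ Equiv.swap 0 i) := by
  set σ : Equiv.Perm (Fin (n + 1)) := Equiv.swap 0 i with hσ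
  have hfun : Ψ ∘ (relabelCLM σ : Config (n + 1) → Config (n + 1)) = Ψ :=
    funext fun Y => hsymm σ Y
  have h1 : HasFDerivAt Ψ (fderiv ℝ Ψ (X ∘ σ)) (relabelCLM σ X) := (hΨ _).hasFDerivAt
  have h2 := h1.comp X (relabelCLM σ).hasFDerivAt
  rw [hfun] at h2
  have hd : fderiv ℝ Ψ X = (fderiv ℝ Ψ (X ∘ σ)).comp (relabelCLM σ) := h2.fderiv
  unfold kinPartE
  rw [hd]
  simp only [ContinuousLinearMap.comp_apply, relabelCLM_apply, single_comp_perm, hσ,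
    Equiv.symm_swap, Equiv.swap_apply_right]

/-- **Every particle carries the same kinetic energy**:
`∫_{cell} ∑ₖ|∂_{i,k}Ψ|² = ∫_{cell} ∑ₖ|∂_{0,k}Ψ|²` for Bose-symmetric `Ψ ∈ C¹` (relabelling
invariance of Lebesgue measure on the cell). [folklore] -/
theorem setLIntegral_kinPartE_eq (L : ℝ) {Ψ : Config (n + 1) → ℂ} (hΨ : ContDiff ℝ 1 Ψ)
    (hsymm : ∀ (σ : Equiv.Perm (Fin (n + 1))) (X : Config (n + 1)), Ψ (X ∘ σ) = Ψ X)
    (i : Fin (n + 1)) :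
    ∫⁻ X in cellN (n + 1) L, kinPartE i Ψ X = ∫⁻ X in cellN (n + 1) L, kinPartE 0 Ψ X :=
  calc ∫⁻ X in cellN (n + 1) L, kinPartE i Ψ X
      = ∫⁻ X in cellN (n + 1) L, kinPartE 0 Ψ (X ∘ Equiv.swap 0 i) :=
        lintegral_congr fun X =>
          kinPartE_eq_comp_swap (hΨ.differentiable one_ne_zero) hsymm i X
    _ = ∫⁻ X in cellN (n + 1) L, kinPartE 0 Ψ X :=
        setLIntegral_cellN_comp_perm (Equiv.swap 0 i) (kinPartE 0 Ψ)

/-- **The total kinetic energy is `N` times that of one particle** (Bose symmetry):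
`∫_{cell}|∇Ψ|² = (n+1) ∫_{cell} ∑ₖ|∂_{0,k}Ψ|²`. [folklore] -/
theorem lintegral_kineticDensity_eq_mul (L : ℝ) {Ψ : Config (n + 1) → ℂ} (hΨ : ContDiff ℝ 1 Ψ)
    (hsymm : ∀ (σ : Equiv.Perm (Fin (n + 1))) (X : Config (n + 1)), Ψ (X ∘ σ) = Ψ X) :
    ∫⁻ X in cellN (n + 1) L, kineticDensity Ψ X =
      ((n + 1 : ℕ) : ℝ≥0∞) * ∫⁻ X in cellN (n + 1) L, kinPartE 0 Ψ X := by
  rw [show (fun X => kineticDensity Ψ X) = fun X => ∑ i, kinPartE i Ψ X from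
      funext (kineticDensity_eq_sum_kinPartE Ψ),
    lintegral_finsetSum _ fun i _ => measurable_kinPartE i hΨ,
    Finset.sum_congr rfl fun i _ => setLIntegral_kinPartE_eq L hΨ hsymm i, Finset.sum_const,
    Finset.card_univ, Fintype.card_fin, nsmul_eq_mul]

end Bose

end CellNormRetention

/-! ## The registered sub-goal of this helper file -/

/-- **Registered sub-goal `cellNormRetention_kineticBoseSymmetry`** (stub of crux item
stmt-AtomisticToContinuum-9674, registered for this helper file; its one-line signature is
`CellNormRetention.lintegral_kineticDensity_eq_mul` written out with global names only): on the
torus cell the kinetic energy of a Bose-symmetric `C¹` function is `N` times that of particle `0`.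
[folklore] -/
theorem cellNormRetention_kineticBoseSymmetry : ∀ (n : ℕ) (L : ℝ) (Ψ : (Fin (n + 1) → EuclideanSpace ℝ (Fin 3)) → ℂ), ContDiff ℝ 1 Ψ → (∀ (σ : Equiv.Perm (Fin (n + 1))) (X : Fin (n + 1) → EuclideanSpace ℝ (Fin 3)), Ψ (X ∘ σ) = Ψ X) → MeasureTheory.lintegral (MeasureTheory.Measure.restrict MeasureTheory.volume (Literature.MathematicalPhysics.QuantumManyBody.BoseGas.cellN (n + 1) L)) (fun X => Literature.MathematicalPhysics.QuantumManyBody.BoseGas.kineticDensity Ψ X) = ((n + 1 : ℕ) : ENNReal) * MeasureTheory.lintegral (MeasureTheory.Measure.restrict MeasureTheory.volume (Literature.MathematicalPhysics.QuantumManyBody.BoseGas.cellN (n + 1) L)) (fun X => ∑ k : Fin 3, ((‖fderiv ℝ Ψ X (Pi.single 0 (EuclideanSpace.single k (1 : ℝ)))‖₊ : NNReal) : ENNReal) ^ 2) :=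
  fun _ L _ hΨ hsymm => CellNormRetention.lintegral_kineticDensity_eq_mul L hΨ hsymm


end Summit.AtomisticToContinuum.BoseEinsteinCondensation.Cruxes.LatticeToPeriodicBridge.CoarseCellLorentzian

end
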